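import Summits.ValiantsHypothesis.ValiantsHypothesis.Theorems.FifoMatchingNNDivisionHardLocatedRowsTogetherFace
import HarnessLib

/-!
(PART 11b of the port — continuation of `…LocatedRowsTogetherFace` (11a), split at `exists_common_pin_of_sparse` for the 400-line cap by the presser val-port-4 g3; texts verbatim.)
# LOCATED ROWS — part 11 — §7 the TOGETHER FACE (independent typing of 38 g2's sparse-cube certificate geometry, up to plumbing)

Theorems-side port (staged by val-idea-40 g5; press as `Theorems/FifoMatchingNNDivisionHardLocatedRowsTogetherFace.lean`,
`--kind proof --supports stmt-ValiantsHypothesis-21181 --as helper`) of §7 of the crux workfile `Cruxes/NNDivisionHard/LocatedRows.lean`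
REV 11 @80a90c42bbb7 (critic of record val-idea-crit-9 g2: V#81 rev 9 KEEP ★★ row 100, V#87 rev 11 KEEP ★★ row 108).  THEOREM OF
RECORD for «sparse-generator affine cubes are decided by C′» is 38 g2's `ExactPencil38` §12 `cor_add_sparseCube_bound` /
`cor_add_sparseCube_decided` (V#83 ★★★); this file is the complementary LocatedRows-currency typing of the same geometry.

* `blockW` (`W₀ = Σ_i (𝟙_{A_i}𝟙_{A_i}ᵀ − |A_i|·diag 𝟙_{A_i})`), `blockW_dotProduct_udPt` (`= Σ_i |b∩A_i|(|b∩A_i| − |A_i|)`),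
  `_nonpos`, ★ `_eq_zero_iff` (the together face), `hCOR_blockW = 0`, `_le_neg_one`, `blockW_tight_biUnion`, `card_reps_inter_biUnion`;
* `exists_common_pin` (finite avoidance), `exists_pin_of_vanishing_column` (constructive non-blocky pin), `exists_common_pin_of_sparse`;
* `togetherFace_ud_block` (UDISJ_k read), `cubePt_le_of_pins` (row-free common maximiser), `l1` bounds, `flat_smul'`,
  ★★ `exists_togetherFace_weight` (`W := λ•(c•blockW A + V)`: `hCOR W = 0`, face-tight, `|⟨udRow a, G t⟩| < |⟨W, G t⟩|` for all `a, t`).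

HONEST LABEL: support lemmas for an OPEN crux; the deciding theorem lives in 38 g2's file; 21181 `NNDivisionHard`, `ExactPencilLaw`
(C′), `allRows.Law`, COR-VIRTUAL are OPEN.  VP ≠ VNP is NOT proved here or anywhere in this tree.
-/

set_option autoImplicit false

-- the mandated summit-side namespace repeats a component by design (single-problem summit)
set_option linter.dupNamespace false

noncomputable section

open Matrix Finset
open scoped Pointwise

namespace Summit.ValiantsHypothesis.ValiantsHypothesis.Theorems.FifoMatching.LocatedRows

open Literature.Barriers.PneNP (HasEFOfSize three_pow_le_card_mul_two_pow_of_cover_univ)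
open Literature.Combinatorics.Optimization.FixedSizePsdRank (Cube bvec flat vecOuter corPolytope flat_dotProduct_vecOuter
  flat_dotProduct_le_of_mem_corPolytope)
open Summit.ValiantsHypothesis.ValiantsHypothesis.Theorems.FifoMatching.XcDivision
  (udInd udPt udRow udMat udInd_apply udInd_sq udInd_inter ud_data udRow_dotProduct_flat_diagonal flat_dotProduct_flat
    dot_le_of_mem_convexHull)
open Summit.ValiantsHypothesis.Theorems.NNDivisionHardNegative.CliqueRowBlind (sum_udInd_mem sum_udInd_univ)
open Summit.ValiantsHypothesis.ValiantsHypothesis.Theorems.FifoMatching.GridCorShadow (four_T_lt_two_pow)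
open Summit.ValiantsHypothesis.Theorems.NNDivisionHardNegative.DiagTilted
  (qOff qOffMat qOff_eq hasEFOfSize_qOff udRow_dotProduct_qOff udInd_compl udInd_univ)

section TogetherFace
variable {n : ℕ}

/-- ★ THE UD-PART OF THE TOGETHER-FACE BLOCK: for pairwise disjoint blocks with representatives `x i ∈ A i` and ANY weight `W`
tight on the block unions with `h_COR(W) = 0` (e.g. `W = μ • blockW A + λ • V`, `V ⊥` the face, `μ ≫ λ`), the located exact slack of
row `(x(α), W)` against column `b_S = ⋃_{i∈S} A_i` is the UDISJ_k entry `(1 − |α ∩ S|)²`.  (The passenger part — a COMMON maximiser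
`H⋆ = {t : 0 < ⟨W, G t⟩}` once `W` pins every generator beyond the clique weights — is 38 g2's §9 engine; with it the block is pure
and `three_pow_le_of_block` gives `3^k ≤ (r+1)·2^k`.) -/
theorem togetherFace_ud_block {k : ℕ} (A : Fin k → Finset (Fin n)) (hA : ∀ i j, i ≠ j → Disjoint (A i) (A j))
    (x : Fin k → Fin n) (hx : ∀ i, x i ∈ A i) (W : Matrix (Fin n) (Fin n) ℝ)
    (hface : ∀ S : Finset (Fin k), flat W ⬝ᵥ udPt (S.biUnion A) = 0) (hW : hCOR W = 0) (α S : Finset (Fin k)) :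
    (1 + hCOR W) - (udRow (α.image x) + flat W) ⬝ᵥ udPt (S.biUnion A) = (1 - ((α ∩ S).card : ℝ)) ^ 2 := by
  classical
  obtain ⟨-, -, slack, -⟩ := ud_data n
  have hs := slack (α.image x) (S.biUnion A)
  rw [card_reps_inter_biUnion A hA x hx α S] at hs
  rw [add_dotProduct, hface S, hW]
  linarith

/-- ★ THE PASSENGER PART (row-free common maximiser from STRONG PINS): if the weight `W` pins every generator beyond the clique
weight of the row (`|⟨udRow a, G t⟩| < |⟨W, G t⟩|`), then `H⋆ := {t : 0 < ⟨W, G t⟩}` — which does not depend on the row — maximises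
the row `udRow a + flat W` over ALL cube points.  (With `W = μ • blockW A + λ • V` from `exists_common_pin_of_sparse` and `μ, λ`
large this holds for every row at once: 38 g2's sparse-cube certificate; only the scaling arithmetic is left.) -/
theorem cubePt_le_of_pins {N : ℕ} (Q₀ : Matrix (Fin n) (Fin n) ℝ) (G : Fin N → Matrix (Fin n) (Fin n) ℝ)
    (W : Matrix (Fin n) (Fin n) ℝ) (a : Finset (Fin n))
    (hpin : ∀ t, |udRow a ⬝ᵥ flat (G t)| < |flat W ⬝ᵥ flat (G t)|) (P : Finset (Fin N)) :
    (udRow a + flat W) ⬝ᵥ cubePt Q₀ G P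
      ≤ (udRow a + flat W) ⬝ᵥ cubePt Q₀ G (Finset.univ.filter fun t => 0 < flat W ⬝ᵥ flat (G t)) := by
  classical
  set ρ := udRow a + flat W with hρ
  have hs : ∀ t, ρ ⬝ᵥ flat (G t) = udRow a ⬝ᵥ flat (G t) + flat W ⬝ᵥ flat (G t) := fun t => by
    rw [hρ, add_dotProduct]
  have hsgn : ∀ t, 0 < ρ ⬝ᵥ flat (G t) ↔ 0 < flat W ⬝ᵥ flat (G t) := fun t => by
    have h := hpin t
    rw [hs t]
    rw [abs_lt] at h
    rcases lt_or_ge 0 (flat W ⬝ᵥ flat (G t)) with hw | hw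
    · rw [abs_of_pos hw] at h
      exact ⟨fun _ => hw, fun _ => by linarith [h.1]⟩
    · rw [abs_of_nonpos hw] at h
      exact ⟨fun h' => by linarith [h.2], fun h' => absurd h' (not_lt.2 hw)⟩
  have hfilter : (Finset.univ.filter fun t => 0 < flat W ⬝ᵥ flat (G t)) = Finset.univ.filter fun t => 0 < ρ ⬝ᵥ flat (G t) :=
    Finset.filter_congr fun t _ => (hsgn t).symm
  rw [hfilter, dotProduct_cubePt, dotProduct_cubePt]
  have h1 : ∑ t ∈ P, ρ ⬝ᵥ flat (G t) ≤ ∑ t ∈ P.filter (fun t => 0 < ρ ⬝ᵥ flat (G t)), ρ ⬝ᵥ flat (G t) := by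
    rw [← Finset.sum_filter_add_sum_filter_not P (fun t => 0 < ρ ⬝ᵥ flat (G t))]
    have : ∑ t ∈ P.filter (fun t => ¬ 0 < ρ ⬝ᵥ flat (G t)), ρ ⬝ᵥ flat (G t) ≤ 0 :=
      Finset.sum_nonpos fun t ht => not_lt.1 (Finset.mem_filter.1 ht).2
    linarith
  have h2 : ∑ t ∈ P.filter (fun t => 0 < ρ ⬝ᵥ flat (G t)), ρ ⬝ᵥ flat (G t)
      ≤ ∑ t ∈ Finset.univ.filter (fun t => 0 < ρ ⬝ᵥ flat (G t)), ρ ⬝ᵥ flat (G t) :=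
    Finset.sum_le_sum_of_subset_of_nonneg (Finset.filter_subset_filter _ (Finset.subset_univ P))
      fun t ht _ => le_of_lt (Finset.mem_filter.1 ht).2
  linarith

/-- entrywise `ℓ¹` mass of a matrix -/
def l1 (M : Matrix (Fin n) (Fin n) ℝ) : ℝ := ∑ i, ∑ j, |M i j|

/-- `l1 M ≥ 0`. -/
theorem l1_nonneg (M : Matrix (Fin n) (Fin n) ℝ) : 0 ≤ l1 M :=
  Finset.sum_nonneg fun _ _ => Finset.sum_nonneg fun _ _ => abs_nonneg _

/-- `|⟨M, x_b x_bᵀ⟩| ≤ ‖M‖₁`. -/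
theorem abs_flat_dotProduct_udPt_le (M : Matrix (Fin n) (Fin n) ℝ) (b : Finset (Fin n)) :
    |flat M ⬝ᵥ udPt b| ≤ l1 M := by
  classical
  rw [flat_dotProduct_udPt_eq]
  calc |∑ p ∈ b, ∑ q ∈ b, M p q| ≤ ∑ p ∈ b, |∑ q ∈ b, M p q| := Finset.abs_sum_le_sum_abs _ _
    _ ≤ ∑ p ∈ b, ∑ q ∈ b, |M p q| := Finset.sum_le_sum fun p _ => Finset.abs_sum_le_sum_abs _ _
    _ ≤ ∑ p ∈ b, ∑ q, |M p q| :=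
        Finset.sum_le_sum fun p _ => Finset.sum_le_sum_of_subset_of_nonneg (Finset.subset_univ b) fun q _ _ => abs_nonneg _
    _ ≤ ∑ p, ∑ q, |M p q| :=
        Finset.sum_le_sum_of_subset_of_nonneg (Finset.subset_univ b) fun p _ _ =>
          Finset.sum_nonneg fun q _ => abs_nonneg _

/-- The clique matrix has entries in `{−1, 0, 1}`. -/
theorem abs_udMat_le_one (a : Finset (Fin n)) (i j : Fin n) : |udMat a i j| ≤ 1 := by
  classical
  unfold udMat
  simp only [udInd_apply]
  rcases eq_or_ne i j with rfl | hij
  · by_cases hi : i ∈ a <;> norm_num [hi]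
  · by_cases hi : i ∈ a <;> by_cases hj : j ∈ a <;> norm_num [hi, hj, hij]

/-- `|⟨udRow a, g⟩| ≤ ‖g‖₁` for every row index `a`. -/
theorem abs_udRow_dotProduct_flat_le (a : Finset (Fin n)) (g : Matrix (Fin n) (Fin n) ℝ) :
    |udRow a ⬝ᵥ flat g| ≤ l1 g := by
  classical
  rw [udRow, flat_dotProduct_flat]
  calc |∑ i, ∑ j, udMat a i j * g i j| ≤ ∑ i, |∑ j, udMat a i j * g i j| := Finset.abs_sum_le_sum_abs _ _
    _ ≤ ∑ i, ∑ j, |udMat a i j * g i j| := Finset.sum_le_sum fun i _ => Finset.abs_sum_le_sum_abs _ _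
    _ ≤ ∑ i, ∑ j, |g i j| := Finset.sum_le_sum fun i _ => Finset.sum_le_sum fun j _ => by
        rw [abs_mul]
        calc |udMat a i j| * |g i j| ≤ 1 * |g i j| :=
              mul_le_mul_of_nonneg_right (abs_udMat_le_one a i j) (abs_nonneg _)
          _ = |g i j| := one_mul _

/-- `flat` commutes with scalars. -/
theorem flat_smul' (c : ℝ) (A : Matrix (Fin n) (Fin n) ℝ) : flat (c • A) = c • flat A := by
  funext p; simp [flat, Matrix.smul_apply]

/-- ★★ THE TOGETHER-FACE WEIGHT (38 g2's `W = μ W₀ + λ V`, SCALING DONE IN KERNEL): from ONE `V` orthogonal to the together face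
and seeing every generator (`exists_common_pin_of_sparse`), the weight `W := λ • (c • blockW A + V)` with `c ≥ ‖V‖₁ + 1` off a
finite bad set and `λ` large has `h_COR(W) = 0`, is TIGHT on the whole together face, and PINS EVERY GENERATOR BEYOND EVERY
CLIQUE WEIGHT: `|⟨udRow a, G t⟩| < |⟨W, G t⟩|` for ALL rows `a` and all `t` — so (`cubePt_le_of_pins`) `H⋆ = {t : 0 < ⟨W, G t⟩}`
is a COMMON maximiser of every located row `(a, W)`, and (`togetherFace_ud_block`) the representative rows × block unions read
UDISJ_k exactly. -/
theorem exists_togetherFace_weight {k N : ℕ} (A : Fin k → Finset (Fin n)) (G : Fin N → Matrix (Fin n) (Fin n) ℝ)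
    (V : Matrix (Fin n) (Fin n) ℝ) (hVface : ∀ b : Finset (Fin n), (∀ i, b ∩ A i = ∅ ∨ A i ⊆ b) → flat V ⬝ᵥ udPt b = 0)
    (hVpin : ∀ t, flat V ⬝ᵥ flat (G t) ≠ 0) :
    ∃ W : Matrix (Fin n) (Fin n) ℝ, hCOR W = 0 ∧
      (∀ b : Finset (Fin n), (∀ i, b ∩ A i = ∅ ∨ A i ⊆ b) → flat W ⬝ᵥ udPt b = 0) ∧
      ∀ (a : Finset (Fin n)) (t : Fin N), |udRow a ⬝ᵥ flat (G t)| < |flat W ⬝ᵥ flat (G t)| := by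
  classical
  set w : Fin N → ℝ := fun t => flat (blockW A) ⬝ᵥ flat (G t) with hw_def
  set v : Fin N → ℝ := fun t => flat V ⬝ᵥ flat (G t) with hv_def
  -- Step 1: a multiplier `c ≥ ‖V‖₁ + 1` avoiding the finitely many cancellations `c * w t + v t = 0`.
  have hc : ∃ c : ℝ, l1 V + 1 ≤ c ∧ ∀ t, c * w t + v t ≠ 0 := by
    let bad : Finset ℝ := Finset.univ.image fun t => -(v t) / (w t)
    by_contra hno
    push Not at hno
    have hsub : ∀ j ∈ Finset.range (bad.card + 1), (l1 V + 1 + (j : ℝ)) ∈ bad := by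
      intro j _
      obtain ⟨t, ht⟩ := hno (l1 V + 1 + j) (by have := (Nat.cast_nonneg j : (0 : ℝ) ≤ j); linarith)
      have hw : w t ≠ 0 := by
        intro hw
        apply hVpin t
        have : v t = 0 := by rw [hw, mul_zero, zero_add] at ht; exact ht
        exact this
      refine Finset.mem_image.2 ⟨t, Finset.mem_univ _, ?_⟩
      rw [eq_comm, eq_div_iff hw]
      linarith
    have hcard := Finset.card_le_card_of_injOn (fun j : ℕ => l1 V + 1 + (j : ℝ))
      (fun j hj => hsub j (Finset.mem_coe.1 hj))
      (fun j₁ _ j₂ _ h => by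
        have h' : (j₁ : ℝ) = j₂ := by
          have := h
          simp only at this
          linarith
        exact_mod_cast h')
    rw [Finset.card_range] at hcard
    omega
  obtain ⟨c, hc1, hc2⟩ := hc
  have hc0 : 0 ≤ c := by linarith [l1_nonneg V]
  -- Step 2: the scale `λ`.
  set lam : ℝ := ∑ t, (l1 (G t) + 1) / |c * w t + v t| + 1 with hlam_def
  have hlam_pos : 0 < lam := by
    have : 0 ≤ ∑ t, (l1 (G t) + 1) / |c * w t + v t| :=
      Finset.sum_nonneg fun t _ => div_nonneg (by linarith [l1_nonneg (G t)]) (abs_nonneg _)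
    linarith
  have hlam_t : ∀ t, l1 (G t) + 1 ≤ lam * |c * w t + v t| := by
    intro t
    have hpos : 0 < |c * w t + v t| := abs_pos.2 (hc2 t)
    have hterm : (l1 (G t) + 1) / |c * w t + v t| ≤ lam := by
      have h1 := Finset.single_le_sum (f := fun t => (l1 (G t) + 1) / |c * w t + v t|)
        (fun t _ => div_nonneg (by linarith [l1_nonneg (G t)]) (abs_nonneg _)) (Finset.mem_univ t)
      linarith
    calc l1 (G t) + 1 = (l1 (G t) + 1) / |c * w t + v t| * |c * w t + v t| := by
          rw [div_mul_cancel₀ _ hpos.ne']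
      _ ≤ lam * |c * w t + v t| := mul_le_mul_of_nonneg_right hterm (abs_nonneg _)
  -- The weight.
  have hflat : flat (lam • (c • blockW A + V)) = lam • (c • flat (blockW A) + flat V) := by
    rw [flat_smul', flat_add', flat_smul']
  have hWb : ∀ b : Finset (Fin n), flat (lam • (c • blockW A + V)) ⬝ᵥ udPt b
      = lam * (c * (flat (blockW A) ⬝ᵥ udPt b) + flat V ⬝ᵥ udPt b) := fun b => by
    rw [hflat, smul_dotProduct, add_dotProduct, smul_dotProduct, smul_eq_mul, smul_eq_mul]
  have hWg : ∀ t, flat (lam • (c • blockW A + V)) ⬝ᵥ flat (G t) = lam * (c * w t + v t) := fun t => by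
    rw [hflat, smul_dotProduct, add_dotProduct, smul_dotProduct, smul_eq_mul, smul_eq_mul]
  have hface : ∀ b : Finset (Fin n), (∀ i, b ∩ A i = ∅ ∨ A i ⊆ b) → flat (lam • (c • blockW A + V)) ⬝ᵥ udPt b = 0 := by
    intro b hb
    rw [hWb, (blockW_dotProduct_udPt_eq_zero_iff A b).2 hb, hVface b hb]; ring
  have hnonpos : ∀ b : Finset (Fin n), flat (lam • (c • blockW A + V)) ⬝ᵥ udPt b ≤ 0 := by
    intro b
    by_cases hb : ∀ i, b ∩ A i = ∅ ∨ A i ⊆ b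
    · exact (hface b hb).le
    · rw [hWb]
      have h1 := blockW_dotProduct_udPt_le_neg_one A b hb
      have h2 := abs_flat_dotProduct_udPt_le V b
      have h3 : flat V ⬝ᵥ udPt b ≤ l1 V := (le_abs_self _).trans h2
      have h4 : c * (flat (blockW A) ⬝ᵥ udPt b) ≤ -c := by nlinarith
      have : c * (flat (blockW A) ⬝ᵥ udPt b) + flat V ⬝ᵥ udPt b ≤ 0 := by linarith
      exact mul_nonpos_iff.2 (Or.inl ⟨hlam_pos.le, this⟩)
  refine ⟨lam • (c • blockW A + V), ?_, hface, fun a t => ?_⟩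
  · apply le_antisymm
    · obtain ⟨b, hb⟩ := exists_eq_hCOR (lam • (c • blockW A + V))
      rw [← hb]; exact hnonpos b
    · have h := le_hCOR (lam • (c • blockW A + V)) ∅
      have h0 := hface ∅ fun i => Or.inl (Finset.empty_inter _)
      linarith
  · rw [hWg, abs_mul, abs_of_pos hlam_pos]
    have := abs_udRow_dotProduct_flat_le a (G t)
    linarith [hlam_t t]

end TogetherFace

end Summit.ValiantsHypothesis.ValiantsHypothesis.Theorems.FifoMatching.LocatedRows
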